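import Literature.Geometry.Symplectic.SteinBallContact
import Literature.Topology.FourManifolds.ClosedBallSmoothMaps
import HarnessLib

/-!
# The standard Legendrian unknot in `∂B⁴ = S³`: a Legendrian knot, its Seifert framing, and
# `tb = -1` — the contact layer of the Stein vocabulary is inhabited, with the right signs

Topic `Literature/Geometry/Symplectic`; sibling of `SteinBall.lean` (the standard Stein structure
`steinStructureClosedBall = (J₀, ‖z‖²)` on the closed unit ball of `ℂ²`), `SteinBallContact.lean`
(its contact planes, contact form `α = 2⟪J₀x, Dι ·⟫` and Kähler form `ω = 4⟪J₀ Dι ·, Dι ·⟫` on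
`∂B⁴ = S³`) and `SteinBoundaryContact.lean` (the vocabulary `IsLegendrianKnot`, `IsKnotFraming`,
`canonicalFraming`, `SteinStructure.twisting`, `SteinStructure.defect` in which Eliashberg's
Legendrian-surgery theorem — Akbulut–Matveyev (1998), Thm. 2 (2) = Gompf (1998), Thm. 1.3 — and
the defect of a `2`-handle, AM §3, are phrased).  That vocabulary had no inhabitant in the tree;
this file supplies the model one and **proves** everything about it:

* `legendrianUnknot : 𝕊¹ → B⁴`, `u ↦ (u₀, 0, u₁, 0)` — the real unit circle `S³ ∩ ℝ²`
  (`ℝ² = {Im z₁ = Im z₂ = 0}`), the standard Legendrian unknot of `(S³, ξ_std)`;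
* `isLegendrianKnot_legendrianUnknot` — **it is a Legendrian knot in `∂B⁴`** for
  `steinStructureClosedBall.J`: a `C^∞` embedding (`isSmoothEmbedding_legendrianUnknot`) into the
  boundary whose tangent vectors lie in the complex tangencies `ξ = TS³ ∩ J₀TS³` (the real plane is
  totally real, `inner_stdComplexStructure_realPlane`).  The embedding property is checked on
  Mathlib's definition of immersions (charts in which the map is a linear injection
  `u ↦ L (u, 0)`): **stereographic projection commutes with the linear isometric embedding of
  the real circle** — in the charts `stereographic' 1 (-u)` of `𝕊¹` and
  `closedBallBoundaryChart (Au)` of `B⁴` (`ClosedBall.lean`) the knot reads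
  `w ↦ (0, unknotStereoLin w)` with `unknotStereoLin = B₃ ∘ A ∘ B₁⁻¹` linear injective
  (`stereographic'_legendrianUnknotSphere`; `Bᵢ` Mathlib's orthonormal identifications
  `(ℝv)ᗮ ≃ ℝⁿ`), completed to a linear isomorphism `ℝ¹ × F ≃ ℝ⁴` by a complement of its range
  (`exists_continuousLinearEquiv_of_injective`);
* `seifertFraming = Dι⁻¹ e₁` (`e₁ = ∂/∂x₁`) — the `0`-framing of the unknot (the normal of `K₀` in
  the great `2`-sphere `{x₃ = 0} ∩ S³`, a hemisphere of which it bounds), and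
  `isKnotFraming_seifertFraming` — it is a framing of `K₀` in `∂B⁴` (continuous into `TB⁴` since
  `x ↦ Dι_x⁻¹ e₁` is a smooth vector field, `contMDiff_tangentSection_iff_closedBall`; tangent to
  `S³`; nowhere tangent to `K₀`);
* `closedBallCoeDeriv_knotVelocity_legendrianUnknot` — the velocity `ċ(t)` of the unit-period
  parametrisation reads `2π(-sin 2πt, 0, cos 2πt, 0)` ambiently;
* `twistingLoop_legendrianUnknot_seifertFraming` — the twisting loop `(ω(ċ, ν), α(ν))` of the
  Seifert framing is the ellipse `t ↦ (-8π sin 2πt, 2 cos 2πt)`, traversed counter-clockwise, and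
  **`twisting_legendrianUnknot_seifertFraming : twisting K₀ ν_Seifert = 1`** (Rouché comparison
  with `i (4π + 1) e^{2πit}`, `Literature.Topology.PlaneTopology.wind_eq_of_norm_sub_lt`): the
  Seifert framing is ONE RIGHT-HANDED twist away from the canonical framing, i.e. `tb(K₀) = -1`
  (`f - tb = 0 - (-1)`), Gompf (1998), §1 / Fig. 1 (the Legendrian unknot with `tb = -1`).  This
  pins, on the model, the sign convention of `SteinStructure.twisting` on which the statement of
  Eliashberg's theorem ("framing `tb - 1`" = twisting `-1`) depends; consequently
  `defect K₀ ν_Seifert = 2 ≠ 0` (`defect_legendrianUnknot_seifertFraming`): the `0`-framed unknot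
  is not covered by Eliashberg's theorem (`B⁴ ∪ h = S² × D²` is indeed not Stein);
* `IsLegendrianKnot.twisting_canonicalFraming` (general `W`) — the canonical framing `J ċ` of a
  Legendrian knot has twisting number `0` (its twisting loop is real positive,
  `IsLegendrianKnot.twistingLoop_canonicalFraming`).

## References

* R. E. Gompf, *Handlebody construction of Stein surfaces*, Ann. of Math. 148 (1998), 619–693,
  §1 (Legendrian knots in `(S³, ξ_std)`, canonical framing, `tb` of the Legendrian unknot).
  [Gompf1998]
* S. Akbulut, R. Matveyev, *A convex decomposition theorem for 4-manifolds*, IMRN 1998, no. 7,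
  371–381, §1 and §3 (defect). [AkbulutMatveyev1998]
* J. M. Lee, *Introduction to Smooth Manifolds*, 2nd ed. (2013), Ch. 4–5 (immersions, embeddings).

## Design notes

* All computations are ambient, through the differential `Dι_x = closedBallCoeDeriv x` of the
  inclusion `B⁴ ↪ ℝ⁴` (`ClosedBallTangent.lean`) and the formulas of `SteinBallContact.lean`;
  equations between differentials are stated at plain operator types `ℝ →L[ℝ] ℝ⁴` before
  evaluation (tangent-space synonyms block rewriting).
* `coe_legendrianUnknotSphere` is not a `simp` lemma on purpose (it would rewrite the pole inside
  the type `(ℝ ∙ p)ᗮ` of stereographic charts).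
* No declaration in this file uses `sorry`.
-/

noncomputable section

open scoped Manifold ContDiff Topology RealInnerProductSpace
open Set Function Metric

namespace Literature.Geometry.Symplectic

open Literature.Topology.FourManifolds

/-- The model vector space `ℝ⁴` of the tangent spaces. [folklore] -/
local notation "E4" => EuclideanSpace ℝ (Fin 4)
/-- The plane `ℝ²`. [folklore] -/
local notation "E2" => EuclideanSpace ℝ (Fin 2)
/-- The closed unit 4-ball. [folklore] -/
local notation "𝔻⁴" => (Metric.closedBall (0 : EuclideanSpace ℝ (Fin 4)) 1)
/-- Local notation: `𝕊 n` is the unit sphere in `EuclideanSpace ℝ (Fin (n + 1))`. -/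
local notation "𝕊 " n:arg => (Metric.sphere (0 : EuclideanSpace ℝ (Fin (n + 1))) 1)

attribute [local instance] fact_finrank_euclideanSpace_succ

/-! ### The real plane `ℝ² = {Im z₁ = Im z₂ = 0} ⊂ ℂ²` -/

/-- The inclusion of the real plane `ℝ² ↪ ℂ² = ℝ⁴`, `(a, b) ↦ (a, 0, b, 0)` (real parts of
`z₁ = x₀ + i x₁`, `z₂ = x₂ + i x₃`), as a linear map. [folklore] -/
def realPlaneLin : E2 →ₗ[ℝ] E4 where
  toFun u := WithLp.toLp 2 ![u 0, 0, u 1, 0]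
  map_add' u v := by
    ext i; fin_cases i <;> simp
  map_smul' c u := by
    ext i; fin_cases i <;> simp

/-- Coordinate `0` of `realPlaneLin u = (u₀, 0, u₁, 0)`. [folklore] -/
@[simp] theorem realPlaneLin_apply_zero (u : E2) : realPlaneLin u 0 = u 0 := rfl

/-- Coordinate `1` of `realPlaneLin u = (u₀, 0, u₁, 0)`. [folklore] -/
@[simp] theorem realPlaneLin_apply_one (u : E2) : realPlaneLin u 1 = 0 := rfl

/-- Coordinate `2` of `realPlaneLin u = (u₀, 0, u₁, 0)`. [folklore] -/
@[simp] theorem realPlaneLin_apply_two (u : E2) : realPlaneLin u 2 = u 1 := rfl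

/-- Coordinate `3` of `realPlaneLin u = (u₀, 0, u₁, 0)`. [folklore] -/
@[simp] theorem realPlaneLin_apply_three (u : E2) : realPlaneLin u 3 = 0 := rfl

/-- Inner products on `ℝ²` in coordinates. [folklore] -/
theorem inner_fin_two (x y : E2) : ⟪x, y⟫ = x 0 * y 0 + x 1 * y 1 := by
  rw [real_inner_comm, PiLp.inner_apply, Fin.sum_univ_two]
  simp only [RCLike.inner_apply, conj_trivial]

/-- The real plane is isometrically embedded. [folklore] -/
theorem inner_realPlaneLin (u v : E2) : ⟪realPlaneLin u, realPlaneLin v⟫ = ⟪u, v⟫ := by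
  rw [inner_fin_four, inner_fin_two]; simp

/-- The inclusion of the real plane as a linear isometry `ℝ² →ₗᵢ ℝ⁴`. [folklore] -/
def realPlane : E2 →ₗᵢ[ℝ] E4 :=
  realPlaneLin.isometryOfInner inner_realPlaneLin

/-- The isometry `realPlane` is `realPlaneLin` as a map. [folklore] -/
@[simp] theorem realPlane_apply (u : E2) : realPlane u = realPlaneLin u := rfl

/-- **The real plane is totally real (Lagrangian)**: `J₀ ℝ² ⊥ ℝ²`. [folklore] -/
theorem inner_stdComplexStructure_realPlane (u v : E2) :
    ⟪stdComplexStructure (realPlaneLin u), realPlaneLin v⟫ = 0 := by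
  rw [inner_fin_four]; simp

/-- The real plane is orthogonal to the imaginary axis `e₁ = ∂/∂x₁`. [folklore] -/
theorem inner_realPlane_single_one (u : E2) :
    ⟪realPlaneLin u, EuclideanSpace.single (1 : Fin 4) (1 : ℝ)⟫ = 0 := by
  rw [inner_fin_four]; simp

/-- `⟪J₀ (a, 0, b, 0), e₁⟫ = a`. [folklore] -/
theorem inner_stdComplexStructure_realPlane_single_one (u : E2) :
    ⟪stdComplexStructure (realPlaneLin u), EuclideanSpace.single (1 : Fin 4) (1 : ℝ)⟫ = u 0 := by
  rw [inner_fin_four]; simp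

/-! ### The Legendrian unknot -/

/-- **The standard Legendrian unknot of `(S³, ξ_std) = ∂B⁴`**: the real unit circle
`u ↦ (u₀, 0, u₁, 0)`, i.e. `S³ ∩ ℝ²`, as a map `𝕊¹ → B⁴`. [cite: Gompf1998, §1] -/
def legendrianUnknot (u : 𝕊 1) : 𝔻⁴ :=
  ⟨realPlaneLin (u : E2), by
    rw [mem_closedBall_zero_iff, ← realPlane_apply, realPlane.norm_map, norm_eq_of_mem_sphere]⟩

/-- The same circle as a map into `S³`. [folklore] -/
def legendrianUnknotSphere (u : 𝕊 1) : 𝕊 3 :=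
  ⟨realPlaneLin (u : E2), by
    rw [mem_sphere_zero_iff_norm, ← realPlane_apply, realPlane.norm_map, norm_eq_of_mem_sphere]⟩

/-- The point of `ℝ⁴` underlying `legendrianUnknot u` is `(u₀, 0, u₁, 0)`. [folklore] -/
@[simp] theorem coe_legendrianUnknot (u : 𝕊 1) :
    ((legendrianUnknot u : 𝔻⁴) : E4) = realPlaneLin (u : E2) := rfl

/-- The point of `ℝ⁴` underlying `legendrianUnknotSphere u` is `(u₀, 0, u₁, 0)` (deliberately not
a `simp` lemma: it would rewrite inside the types of stereographic charts). [folklore] -/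
theorem coe_legendrianUnknotSphere (u : 𝕊 1) :
    ((legendrianUnknotSphere u : 𝕊 3) : E4) = realPlaneLin (u : E2) := rfl

/-- The Legendrian unknot factors through the inclusion `S³ ↪ B⁴`. [folklore] -/
theorem legendrianUnknot_eq_inclusion (u : 𝕊 1) :
    legendrianUnknot u = Set.inclusion sphere_subset_closedBall (legendrianUnknotSphere u) := rfl

/-- The Legendrian unknot lies on the unit sphere. [folklore] -/
theorem norm_coe_legendrianUnknot (u : 𝕊 1) : ‖((legendrianUnknot u : 𝔻⁴) : E4)‖ = 1 := by
  rw [coe_legendrianUnknot, ← realPlane_apply, realPlane.norm_map, norm_eq_of_mem_sphere]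

/-- … i.e. in the boundary `∂B⁴`. [folklore] -/
theorem isBoundaryPoint_legendrianUnknot (u : 𝕊 1) :
    (𝓡∂ 4).IsBoundaryPoint (legendrianUnknot u) :=
  (isBoundaryPoint_iff_norm_eq_one _).2 (norm_coe_legendrianUnknot u)

/-- The Legendrian unknot is injective. [folklore] -/
theorem injective_legendrianUnknot : Injective legendrianUnknot := by
  intro u v h
  have h' : realPlaneLin (u : E2) = realPlaneLin (v : E2) := congrArg (fun x : 𝔻⁴ => (x : E4)) h
  have : (u : E2) = (v : E2) := realPlane.injective h'
  exact Subtype.ext this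

/-- The ambient circle `u ↦ (u₀, 0, u₁, 0) ∈ ℝ⁴` is smooth on `𝕊¹`. [folklore] -/
theorem contMDiff_realPlaneLin_coe :
    ContMDiff (𝓡 1) 𝓘(ℝ, E4) ∞ (fun u : 𝕊 1 => realPlaneLin (u : E2)) :=
  (realPlaneLin.toContinuousLinearMap.contDiff.contMDiff).comp contMDiff_coe_sphere

/-- **The Legendrian unknot is smooth** (as a map into the manifold with boundary `B⁴`).
[folklore] -/
theorem contMDiff_legendrianUnknot : ContMDiff (𝓡 1) (𝓡∂ 4) ∞ legendrianUnknot :=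
  ContMDiff.codRestrict_closedBall contMDiff_realPlaneLin_coe _

/-- The ambient differential of the Legendrian unknot: `Dι ∘ dK = realPlaneLin ∘ d(incl_{S¹})`.
[folklore] -/
theorem closedBallCoeDeriv_mfderiv_legendrianUnknot (u : 𝕊 1) (w : EuclideanSpace ℝ (Fin 1)) :
    closedBallCoeDeriv (legendrianUnknot u) (mfderiv (𝓡 1) (𝓡∂ 4) legendrianUnknot u w) =
      realPlaneLin (mfderiv (𝓡 1) 𝓘(ℝ, E2) (Subtype.val : (𝕊 1) → E2) u w) := by
  have h1 : HasMFDerivAt (𝓡 1) 𝓘(ℝ, E4) (fun u : 𝕊 1 => realPlaneLin (u : E2)) u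
      ((realPlaneLin.toContinuousLinearMap).comp
        (mfderiv (𝓡 1) 𝓘(ℝ, E2) (Subtype.val : (𝕊 1) → E2) u)) :=
    (realPlaneLin.toContinuousLinearMap.hasFDerivAt.hasMFDerivAt).comp u
      ((contMDiff_coe_sphere (m := ∞) u).mdifferentiableAt (by simp)).hasMFDerivAt
  have h2 : HasMFDerivAt (𝓡 1) 𝓘(ℝ, E4) ((Subtype.val : 𝔻⁴ → E4) ∘ legendrianUnknot) u
      ((closedBallCoeDeriv (legendrianUnknot u) : E4 →L[ℝ] E4).comp
        (mfderiv (𝓡 1) (𝓡∂ 4) legendrianUnknot u)) :=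
    (hasMFDerivAt_coe_closedBall (legendrianUnknot u)).comp u
      ((contMDiff_legendrianUnknot u).mdifferentiableAt (by simp)).hasMFDerivAt
  have h3 : ((Subtype.val : 𝔻⁴ → E4) ∘ legendrianUnknot) = fun u : 𝕊 1 => realPlaneLin (u : E2) :=
    rfl
  rw [h3] at h2
  have := h1.mfderiv.symm.trans h2.mfderiv
  exact (congrArg (fun L : EuclideanSpace ℝ (Fin 1) →L[ℝ] E4 => L w) this).symm

/-- Tangent vectors of `𝕊¹ ⊂ ℝ²` are orthogonal to the base point. [folklore] -/
theorem inner_mfderiv_coe_sphere_eq_zero (u : 𝕊 1) (w : EuclideanSpace ℝ (Fin 1)) :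
    ⟪(u : E2), mfderiv (𝓡 1) 𝓘(ℝ, E2) (Subtype.val : (𝕊 1) → E2) u w⟫ = 0 := by
  have hmem : mfderiv (𝓡 1) 𝓘(ℝ, E2) (Subtype.val : (𝕊 1) → E2) u w ∈ (ℝ ∙ (u : E2))ᗮ := by
    rw [← range_mfderiv_coe_sphere (n := 1) u]; exact LinearMap.mem_range_self _ _
  exact (Submodule.mem_orthogonal_singleton_iff_inner_right.1 hmem)

/-- **The tangent vectors of the Legendrian unknot lie in the contact planes** `ξ = TS³ ∩ J₀TS³`.
[cite: Gompf1998, §1] -/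
theorem mfderiv_legendrianUnknot_mem_contactPlane (u : 𝕊 1) (w : EuclideanSpace ℝ (Fin 1)) :
    mfderiv (𝓡 1) (𝓡∂ 4) legendrianUnknot u w ∈ contactPlane ballJ (legendrianUnknot u) := by
  refine (mem_contactPlane_ballJ_iff (norm_coe_legendrianUnknot u) _).2 ?_
  rw [closedBallCoeDeriv_mfderiv_legendrianUnknot, coe_legendrianUnknot]
  exact ⟨by rw [inner_realPlaneLin]; exact inner_mfderiv_coe_sphere_eq_zero u w,
    inner_stdComplexStructure_realPlane _ _⟩

/-! ### Stereographic charts commute with the linear isometric embedding of the real circle -/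

/-- The image of the orthogonal complement of `v ∈ S¹` under the real-plane embedding lies in
the orthogonal complement of its image on `S³`. [folklore] -/
theorem realPlaneLin_mem_orthogonal (v : 𝕊 1) (y : (ℝ ∙ (v : E2))ᗮ) :
    realPlaneLin (y : E2) ∈ (ℝ ∙ ((legendrianUnknotSphere v : 𝕊 3) : E4))ᗮ := by
  rw [Submodule.mem_orthogonal_singleton_iff_inner_right, coe_legendrianUnknotSphere,
    inner_realPlaneLin]
  exact Submodule.mem_orthogonal_singleton_iff_inner_right.1 y.2

/-- The real-plane embedding restricted to orthogonal complements `(ℝv)ᗮ → (ℝ Av)ᗮ`. [folklore] -/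
def realPlaneRestrict (v : 𝕊 1) :
    (ℝ ∙ (v : E2))ᗮ →ₗ[ℝ] (ℝ ∙ ((legendrianUnknotSphere v : 𝕊 3) : E4))ᗮ :=
  (realPlaneLin.comp (Submodule.subtype _)).codRestrict _ (realPlaneLin_mem_orthogonal v)

/-- `realPlaneRestrict` is `realPlaneLin` on underlying vectors. [folklore] -/
@[simp] theorem coe_realPlaneRestrict (v : 𝕊 1) (y : (ℝ ∙ (v : E2))ᗮ) :
    ((realPlaneRestrict v y : (ℝ ∙ ((legendrianUnknotSphere v : 𝕊 3) : E4))ᗮ) : E4) =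
      realPlaneLin (y : E2) := rfl

/-- `realPlaneRestrict` is injective. [folklore] -/
theorem injective_realPlaneRestrict (v : 𝕊 1) : Injective (realPlaneRestrict v) := by
  intro y y' h
  have h' := congrArg (fun z : (ℝ ∙ ((legendrianUnknotSphere v : 𝕊 3) : E4))ᗮ => (z : E4)) h
  simp only [coe_realPlaneRestrict] at h'
  exact Subtype.ext (realPlane.injective h')

/-- Mathlib's identification `(ℝv)ᗮ ≃ ℝ¹` entering `stereographic' 1 v`. [folklore] -/
def stereoFrame1 (v : 𝕊 1) : (ℝ ∙ (v : E2))ᗮ ≃ₗᵢ[ℝ] EuclideanSpace ℝ (Fin 1) :=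
  (OrthonormalBasis.fromOrthogonalSpanSingleton 1 (ne_zero_of_mem_unit_sphere v)).repr

/-- Mathlib's identification `(ℝp)ᗮ ≃ ℝ³` entering `stereographic' 3 p`. [folklore] -/
def stereoFrame3 (q : 𝕊 3) : (ℝ ∙ (q : E4))ᗮ ≃ₗᵢ[ℝ] EuclideanSpace ℝ (Fin 3) :=
  (OrthonormalBasis.fromOrthogonalSpanSingleton 3 (ne_zero_of_mem_unit_sphere q)).repr

/-- **The linear map `ℝ¹ → ℝ³` through which the Legendrian unknot reads in stereographic
charts** (poles `v` on `S¹` and `Av` on `S³`). [folklore] -/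
def unknotStereoLin (v : 𝕊 1) : EuclideanSpace ℝ (Fin 1) →ₗ[ℝ] EuclideanSpace ℝ (Fin 3) :=
  (stereoFrame3 (legendrianUnknotSphere v)).toLinearEquiv.toLinearMap ∘ₗ
    (realPlaneRestrict v) ∘ₗ (stereoFrame1 v).symm.toLinearEquiv.toLinearMap

/-- Unfolding `unknotStereoLin`. [folklore] -/
theorem unknotStereoLin_apply (v : 𝕊 1) (w : EuclideanSpace ℝ (Fin 1)) :
    unknotStereoLin v w =
      stereoFrame3 (legendrianUnknotSphere v) (realPlaneRestrict v ((stereoFrame1 v).symm w)) := rfl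

/-- `unknotStereoLin` is injective. [folklore] -/
theorem injective_unknotStereoLin (v : 𝕊 1) : Injective (unknotStereoLin v) :=
  (stereoFrame3 (legendrianUnknotSphere v)).injective.comp
    ((injective_realPlaneRestrict v).comp (stereoFrame1 v).symm.injective)

/-- **Stereographic projection commutes with the isometric embedding of the real circle**:
`σ_{Av}(As) = A σ_v(s)` in the orthogonal complements. [folklore] -/
theorem coe_stereographic_legendrianUnknotSphere (v s : 𝕊 1) :
    ((stereographic (norm_eq_of_mem_sphere (legendrianUnknotSphere v)) (legendrianUnknotSphere s) :
        (ℝ ∙ ((legendrianUnknotSphere v : 𝕊 3) : E4))ᗮ) : E4) =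
      realPlaneLin ((stereographic (norm_eq_of_mem_sphere v) s : (ℝ ∙ (v : E2))ᗮ) : E2) := by
  simp only [stereographic_apply, Submodule.coe_smul,
    Submodule.coe_orthogonalProjectionOnto_apply,
    Submodule.starProjection_orthogonal_val,
    Submodule.starProjection_unit_singleton ℝ (norm_eq_of_mem_sphere v),
    Submodule.starProjection_unit_singleton ℝ (norm_eq_of_mem_sphere (legendrianUnknotSphere v))]
  change (2 / (1 - ⟪realPlaneLin (v : E2), realPlaneLin (s : E2)⟫)) •
      (realPlaneLin (s : E2) - ⟪realPlaneLin (v : E2), realPlaneLin (s : E2)⟫ • realPlaneLin (v : E2)) = _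
  rw [inner_realPlaneLin, map_smul, map_sub, map_smul]

/-- The same for Mathlib's charts `stereographic'`: `σ'_{Av} ∘ A = unknotStereoLin v ∘ σ'_v`.
[folklore] -/
theorem stereographic'_legendrianUnknotSphere (v s : 𝕊 1) :
    stereographic' 3 (legendrianUnknotSphere v) (legendrianUnknotSphere s) =
      unknotStereoLin v (stereographic' 1 v s) := by
  rw [unknotStereoLin_apply]
  simp only [stereographic', OpenPartialHomeomorph.coe_trans, comp_apply,
    Homeomorph.toOpenPartialHomeomorph_apply, LinearIsometryEquiv.coe_toHomeomorph]
  show stereoFrame3 (legendrianUnknotSphere v) _ = stereoFrame3 (legendrianUnknotSphere v) _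
  congr 1
  show _ = realPlaneRestrict v ((stereoFrame1 v).symm (stereoFrame1 v _))
  rw [LinearIsometryEquiv.symm_apply_apply]
  exact Subtype.ext (coe_stereographic_legendrianUnknotSphere v s)

/-- Antipodes on the Legendrian unknot. [folklore] -/
theorem neg_legendrianUnknotSphere (u : 𝕊 1) :
    -legendrianUnknotSphere u = legendrianUnknotSphere (-u) :=
  Subtype.ext (by rw [coe_neg_sphere, coe_legendrianUnknotSphere, coe_legendrianUnknotSphere,
    coe_neg_sphere, map_neg])

/-! ### The Legendrian unknot is a smooth embedding -/

/-- An injective linear map between finite-dimensional spaces is the restriction to `E × 0` of a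
linear isomorphism `E × F ≃ E''`, `F` a complement of its range. [folklore] -/
theorem exists_continuousLinearEquiv_of_injective {F F'' : Type*} [NormedAddCommGroup F]
    [NormedSpace ℝ F] [FiniteDimensional ℝ F] [NormedAddCommGroup F''] [NormedSpace ℝ F'']
    [FiniteDimensional ℝ F''] (T : F →ₗ[ℝ] F'') (hT : Injective T) :
    ∃ (p : Submodule ℝ F'') (e : (F × p) ≃L[ℝ] F''),
      IsCompl (LinearMap.range T) p ∧ ∀ w, e (w, 0) = T w := by
  obtain ⟨p, hp⟩ := (LinearMap.range T).exists_isCompl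
  refine ⟨p, (((LinearEquiv.ofInjective T hT).prodCongr (LinearEquiv.refl ℝ p)).trans
    (Submodule.prodEquivOfIsCompl _ _ hp)).toContinuousLinearEquiv, hp, fun w => ?_⟩
  simp

/-- The linear model of the Legendrian unknot in the boundary chart: `w ↦ (0, unknotStereoLin w)`.
[folklore] -/
def unknotChartLin (v : 𝕊 1) : EuclideanSpace ℝ (Fin 1) →ₗ[ℝ] E4 :=
  (sphereInclusionComplementEquiv 3).toLinearMap ∘ₗ
    (LinearMap.inl ℝ (EuclideanSpace ℝ (Fin 3)) ℝ) ∘ₗ unknotStereoLin v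

/-- Unfolding `unknotChartLin`. [folklore] -/
theorem unknotChartLin_apply (v : 𝕊 1) (w : EuclideanSpace ℝ (Fin 1)) :
    unknotChartLin v w = sphereInclusionComplementEquiv 3 (unknotStereoLin v w, 0) := rfl

/-- `unknotChartLin` is injective. [folklore] -/
theorem injective_unknotChartLin (v : 𝕊 1) : Injective (unknotChartLin v) :=
  (sphereInclusionComplementEquiv 3).injective.comp
    (LinearMap.inl_injective.comp (injective_unknotStereoLin v))

/-- **The Legendrian unknot is an immersion** `𝕊¹ → B⁴`: at `u`, in the charts
`stereographic' 1 (-u)` and `closedBallBoundaryChart (Au)` it reads `w ↦ (0, unknotStereoLin w)`,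
a linear injection. [folklore] -/
theorem isImmersion_legendrianUnknot :
    Manifold.IsImmersion (𝓡 1) (𝓡∂ 4) ∞ legendrianUnknot := by
  refine Manifold.IsImmersionOfComplement.isImmersion (F := EuclideanSpace ℝ (Fin 3)) fun u => ?_
  obtain ⟨p, e, hp, he⟩ :=
    exists_continuousLinearEquiv_of_injective (unknotChartLin (-u)) (injective_unknotChartLin (-u))
  have hfin : Module.finrank ℝ p = Module.finrank ℝ (EuclideanSpace ℝ (Fin 3)) := by
    have h1 := Submodule.finrank_add_eq_of_isCompl hp
    rw [LinearMap.finrank_range_of_inj (injective_unknotChartLin (-u)), finrank_euclideanSpace_fin,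
      finrank_euclideanSpace_fin] at h1
    rw [finrank_euclideanSpace_fin]; omega
  have hx : u ≠ -u := fun h => ne_neg_of_mem_unit_sphere ℝ u h
  refine (Manifold.IsImmersionAtOfComplement.mk_of_charts e (stereographic' 1 (-u))
    (closedBallBoundaryChart (legendrianUnknotSphere u)) ?_ ?_ ?_ ?_ ?_ ?_).trans_F
    (ContinuousLinearEquiv.ofFinrankEq hfin)
  · simpa using ne_neg_of_mem_unit_sphere ℝ u
  · rw [legendrianUnknot_eq_inclusion]
    refine inclusion_mem_closedBallBoundaryChart_source 3 fun h => hx ?_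
    rw [neg_legendrianUnknotSphere] at h
    have h' := congrArg (fun q : 𝕊 3 => (q : E4)) h
    simp only [coe_legendrianUnknotSphere] at h'
    exact Subtype.ext (realPlane.injective h')
  · exact IsManifold.chart_mem_maximalAtlas u
  · exact IsManifold.subset_maximalAtlas (mem_insert_of_mem _ (mem_range_self _))
  · intro s hs
    rw [stereographic'_source, mem_compl_singleton_iff] at hs
    rw [mem_preimage, legendrianUnknot_eq_inclusion]
    refine inclusion_mem_closedBallBoundaryChart_source 3 fun h => hs ?_
    rw [neg_legendrianUnknotSphere] at h
    have h' := congrArg (fun q : 𝕊 3 => (q : E4)) h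
    simp only [coe_legendrianUnknotSphere] at h'
    exact Subtype.ext (realPlane.injective h')
  · intro w _
    set s : 𝕊 1 := (stereographic' 1 (-u)).symm w with hs
    have hw : stereographic' 1 (-u) s = w := (stereographic' 1 (-u)).right_inv (by simp)
    rw [comp_apply, comp_apply, OpenPartialHomeomorph.extend_coe_symm, comp_apply,
      modelWithCornersSelf_coe_symm, id, ← hs, OpenPartialHomeomorph.extend_coe, comp_apply,
      modelWithCornersEuclideanHalfSpace_apply, coe_closedBallBoundaryChart_apply, comp_apply, he,
      unknotChartLin_apply, sphereInclusionComplementEquiv_apply]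
    have h1 : ‖((legendrianUnknot s : 𝔻⁴) : E4)‖ = 1 := norm_coe_legendrianUnknot s
    have h2 : radialProjection (legendrianUnknotSphere u) ((legendrianUnknot s : 𝔻⁴) : E4) =
        legendrianUnknotSphere s :=
      radialProjection_coe_sphere (legendrianUnknotSphere u) (legendrianUnknotSphere s)
    rw [h1, h2, sub_self, neg_legendrianUnknotSphere, stereographic'_legendrianUnknotSphere, hw]

/-- **The Legendrian unknot is a smooth embedding `𝕊¹ ↪ B⁴`.** [folklore] -/
theorem isSmoothEmbedding_legendrianUnknot :
    Manifold.IsSmoothEmbedding (𝓡 1) (𝓡∂ 4) ∞ legendrianUnknot :=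
  ⟨isImmersion_legendrianUnknot,
    (contMDiff_legendrianUnknot.continuous.isClosedEmbedding injective_legendrianUnknot).isEmbedding⟩

/-- **The standard Legendrian unknot is a Legendrian knot in `∂B⁴`** for the standard Stein
structure. [cite: Gompf1998, §1] -/
theorem isLegendrianKnot_legendrianUnknot :
    IsLegendrianKnot steinStructureClosedBall.J legendrianUnknot where
  isSmoothEmbedding := isSmoothEmbedding_legendrianUnknot
  isBoundaryPoint := isBoundaryPoint_legendrianUnknot
  mfderiv_mem := mfderiv_legendrianUnknot_mem_contactPlane

/-! ### The Seifert framing `e₁ = ∂/∂x₁` and the velocity of the Legendrian unknot -/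

/-- The imaginary axis `e₁ = ∂/∂x₁ = i · ∂/∂x₀` of `ℂ² = ℝ⁴`. [folklore] -/
def imagAxis : E4 := EuclideanSpace.single (1 : Fin 4) (1 : ℝ)

/-- Coordinate `1` of `e₁`. [folklore] -/
@[simp] theorem imagAxis_apply_one : imagAxis 1 = 1 := by simp [imagAxis]

/-- Coordinate `0` of `e₁`. [folklore] -/
@[simp] theorem imagAxis_apply_zero : imagAxis 0 = 0 := by simp [imagAxis]

/-- Coordinate `2` of `e₁`. [folklore] -/
@[simp] theorem imagAxis_apply_two : imagAxis 2 = 0 := by simp [imagAxis]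

/-- Coordinate `3` of `e₁`. [folklore] -/
@[simp] theorem imagAxis_apply_three : imagAxis 3 = 0 := by simp [imagAxis]

/-- `⟪J₀ w, e₁⟫ = w₀`. [folklore] -/
theorem inner_stdComplexStructure_imagAxis (w : E4) : ⟪stdComplexStructure w, imagAxis⟫ = w 0 := by
  rw [inner_fin_four]; simp

/-- `⟪(a, 0, b, 0), e₁⟫ = 0`. [folklore] -/
theorem inner_realPlaneLin_imagAxis (u : E2) : ⟪realPlaneLin u, imagAxis⟫ = 0 := by
  rw [inner_fin_four]; simp

/-- **The constant ambient field `e₁` read in the charts of `B⁴`**: the section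
`x ↦ Dι_x⁻¹ e₁` of `TB⁴`. [folklore] -/
def imagAxisField (x : 𝔻⁴) : E4 := (closedBallCoeDeriv x).symm imagAxis

/-- The ambient representative of `imagAxisField` is the constant `e₁`. [folklore] -/
@[simp] theorem closedBallCoeDeriv_imagAxisField (x : 𝔻⁴) :
    closedBallCoeDeriv x (imagAxisField x) = imagAxis :=
  (closedBallCoeDeriv x).apply_symm_apply imagAxis

/-- The field `Dι⁻¹ e₁` is a smooth vector field on `B⁴` (its ambient representative is
constant; `contMDiff_tangentSection_iff_closedBall`). [folklore] -/
theorem isSmoothVectorField_imagAxisField : IsSmoothVectorField (𝔻⁴) imagAxisField := by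
  unfold IsSmoothVectorField
  rw [contMDiff_tangentSection_iff_closedBall]
  simp only [closedBallCoeDeriv_imagAxisField]
  exact contMDiff_const

/-- **The Seifert framing of the Legendrian unknot**: the normal field `e₁ = ∂/∂x₁` along
`K₀` (the inward normal of `K₀` in the hemisphere `{x₃ = 0, x₁ ≥ 0}` of the great `2`-sphere
`{x₃ = 0} ∩ S³` it bounds — the `0`-framing), read in the charts. [cite: Gompf1998, §1] -/
def seifertFraming (u : 𝕊 1) : E4 := imagAxisField (legendrianUnknot u)

/-- The ambient representative of the Seifert framing is the constant `e₁`. [folklore] -/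
@[simp] theorem closedBallCoeDeriv_seifertFraming (u : 𝕊 1) :
    closedBallCoeDeriv (legendrianUnknot u) (seifertFraming u) = imagAxis :=
  closedBallCoeDeriv_imagAxisField _

/-- The unit-period parametrisation of the real unit circle in `ℝ²`, in coordinates. [folklore] -/
theorem coe_circlePt_eq (t : ℝ) :
    ((circlePt t : 𝕊 1) : E2) =
      Real.cos (2 * Real.pi * t) • EuclideanSpace.single (0 : Fin 2) (1 : ℝ) +
        Real.sin (2 * Real.pi * t) • EuclideanSpace.single (1 : Fin 2) (1 : ℝ) := by
  ext i; fin_cases i <;> simp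

/-- The velocity of the unit-period parametrisation of the unit circle. [folklore] -/
theorem hasDerivAt_coe_circlePt (t : ℝ) :
    HasDerivAt (fun s : ℝ => ((circlePt s : 𝕊 1) : E2))
      ((-(2 * Real.pi * Real.sin (2 * Real.pi * t))) • EuclideanSpace.single (0 : Fin 2) (1 : ℝ) +
        (2 * Real.pi * Real.cos (2 * Real.pi * t)) • EuclideanSpace.single (1 : Fin 2) (1 : ℝ)) t := by
  have h : (fun s : ℝ => ((circlePt s : 𝕊 1) : E2)) = fun s =>
      Real.cos (2 * Real.pi * s) • EuclideanSpace.single (0 : Fin 2) (1 : ℝ) +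
        Real.sin (2 * Real.pi * s) • EuclideanSpace.single (1 : Fin 2) (1 : ℝ) :=
    funext coe_circlePt_eq
  rw [h]
  have hlin : HasDerivAt (fun s : ℝ => 2 * Real.pi * s) (2 * Real.pi) t := by
    simpa using (hasDerivAt_id t).const_mul (2 * Real.pi)
  have hc : HasDerivAt (fun s : ℝ => Real.cos (2 * Real.pi * s))
      (-(2 * Real.pi * Real.sin (2 * Real.pi * t))) t :=
    ((Real.hasDerivAt_cos (2 * Real.pi * t)).comp t hlin).congr_deriv (by ring)
  have hs : HasDerivAt (fun s : ℝ => Real.sin (2 * Real.pi * s))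
      (2 * Real.pi * Real.cos (2 * Real.pi * t)) t :=
    ((Real.hasDerivAt_sin (2 * Real.pi * t)).comp t hlin).congr_deriv (by ring)
  exact (hc.smul_const _).add (hs.smul_const _)

/-- The ambient velocity vector of the Legendrian unknot at parameter `t`:
`2π (-sin 2πt, 0, cos 2πt, 0)`. [folklore] -/
def unknotVelocityAmb (t : ℝ) : E4 :=
  realPlaneLin ((-(2 * Real.pi * Real.sin (2 * Real.pi * t))) • EuclideanSpace.single (0 : Fin 2) (1 : ℝ) +
    (2 * Real.pi * Real.cos (2 * Real.pi * t)) • EuclideanSpace.single (1 : Fin 2) (1 : ℝ))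

/-- Coordinate `0` of the ambient velocity: `-2π sin 2πt`. [folklore] -/
@[simp] theorem unknotVelocityAmb_apply_zero (t : ℝ) :
    unknotVelocityAmb t 0 = -(2 * Real.pi * Real.sin (2 * Real.pi * t)) := by
  simp [unknotVelocityAmb]

/-- Coordinate `1` of the ambient velocity vanishes (the curve stays in the real plane). [folklore] -/
@[simp] theorem unknotVelocityAmb_apply_one (t : ℝ) : unknotVelocityAmb t 1 = 0 := by
  simp [unknotVelocityAmb]

/-- The ambient curve `t ↦ ι(K₀(circlePt t)) = (cos 2πt, 0, sin 2πt, 0)` and its velocity.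
[folklore] -/
theorem hasDerivAt_coe_legendrianUnknot_circlePt (t : ℝ) :
    HasDerivAt (fun s : ℝ => ((legendrianUnknot (circlePt s) : 𝔻⁴) : E4)) (unknotVelocityAmb t) t :=
  (realPlaneLin.toContinuousLinearMap.hasFDerivAt.comp_hasDerivAt t (hasDerivAt_coe_circlePt t))

/-- **The velocity of the Legendrian unknot, read ambiently**:
`Dι (ċ(t)) = 2π (-sin 2πt, 0, cos 2πt, 0)`. [folklore] -/
theorem closedBallCoeDeriv_knotVelocity_legendrianUnknot (t : ℝ) :
    closedBallCoeDeriv (legendrianUnknot (circlePt t)) (knotVelocity legendrianUnknot t) =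
      unknotVelocityAmb t := by
  have hc : MDifferentiableAt 𝓘(ℝ, ℝ) (𝓡∂ 4) (legendrianUnknot ∘ circlePt) t :=
    ((contMDiff_legendrianUnknot _).comp t contMDiff_circlePt.contMDiffAt).mdifferentiableAt (by simp)
  have h2 : HasMFDerivAt 𝓘(ℝ, ℝ) 𝓘(ℝ, E4) ((Subtype.val : 𝔻⁴ → E4) ∘ (legendrianUnknot ∘ circlePt)) t
      ((closedBallCoeDeriv (legendrianUnknot (circlePt t)) : E4 →L[ℝ] E4).comp
        (mfderiv 𝓘(ℝ, ℝ) (𝓡∂ 4) (legendrianUnknot ∘ circlePt) t)) :=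
    (hasMFDerivAt_coe_closedBall (legendrianUnknot (circlePt t))).comp t hc.hasMFDerivAt
  have h1 : HasMFDerivAt 𝓘(ℝ, ℝ) 𝓘(ℝ, E4) ((Subtype.val : 𝔻⁴ → E4) ∘ (legendrianUnknot ∘ circlePt)) t
      (ContinuousLinearMap.smulRight (1 : ℝ →L[ℝ] ℝ) (unknotVelocityAmb t)) :=
    (hasDerivAt_coe_legendrianUnknot_circlePt t).hasFDerivAt.hasMFDerivAt
  have h4 : (closedBallCoeDeriv (legendrianUnknot (circlePt t)) : E4 →L[ℝ] E4)
      (mfderiv 𝓘(ℝ, ℝ) (𝓡∂ 4) (legendrianUnknot ∘ circlePt) t (1 : ℝ)) = unknotVelocityAmb t := by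
    have h3 : ((closedBallCoeDeriv (legendrianUnknot (circlePt t)) : E4 →L[ℝ] E4).comp
        (mfderiv 𝓘(ℝ, ℝ) (𝓡∂ 4) (legendrianUnknot ∘ circlePt) t) : ℝ →L[ℝ] E4) =
        (ContinuousLinearMap.smulRight (1 : ℝ →L[ℝ] ℝ) (unknotVelocityAmb t) : ℝ →L[ℝ] E4) :=
      h2.mfderiv.symm.trans h1.mfderiv
    have h5 := ContinuousLinearMap.ext_iff.1 h3 (1 : ℝ)
    rw [ContinuousLinearMap.comp_apply, ContinuousLinearMap.smulRight_apply] at h5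
    have h6 : ((1 : ℝ →L[ℝ] ℝ) (1 : ℝ) : ℝ) • unknotVelocityAmb t = unknotVelocityAmb t := by simp
    exact h5.trans h6
  exact h4

/-- **The Seifert framing is a framing of the Legendrian unknot in `∂B⁴`.** [folklore] -/
theorem isKnotFraming_seifertFraming : IsKnotFraming legendrianUnknot seifertFraming where
  continuous :=
    (isSmoothVectorField_imagAxisField.continuous).comp contMDiff_legendrianUnknot.continuous
  mem_boundaryTangentSpace u := by
    rw [mem_boundaryTangentSpace_iff,
      apply_zero_eq_neg_inner_closedBallCoeDeriv (norm_coe_legendrianUnknot u),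
      closedBallCoeDeriv_seifertFraming, coe_legendrianUnknot, inner_realPlaneLin_imagAxis, neg_zero]
  not_mem_span t := by
    rw [Submodule.mem_span_singleton]
    rintro ⟨c, hc⟩
    have h := congrArg (fun v : E4 => closedBallCoeDeriv (legendrianUnknot (circlePt t)) v 1) hc
    simp only [map_smul, closedBallCoeDeriv_knotVelocity_legendrianUnknot,
      closedBallCoeDeriv_seifertFraming, PiLp.smul_apply, unknotVelocityAmb_apply_one, smul_eq_mul,
      mul_zero, imagAxis_apply_one] at h
    exact zero_ne_one h

/-! ### The twisting number of the Seifert framing is `+1` (so `tb(K₀) = -1`) -/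

/-- Continuity of a complex-valued function given by continuous real and imaginary parts.
[folklore] -/
theorem continuous_complex_mk {f g : ℝ → ℝ} (hf : Continuous f) (hg : Continuous g) :
    Continuous fun t => (⟨f t, g t⟩ : ℂ) := by
  have h : (fun t => (⟨f t, g t⟩ : ℂ)) = fun t => Complex.equivRealProdCLM.symm (f t, g t) := by
    funext t
    apply Complex.ext <;> simp [Complex.equivRealProdCLM_symm_apply]
  rw [h]
  exact Complex.equivRealProdCLM.symm.continuous.comp (hf.prodMk hg)

/-- **The twisting loop of the Seifert framing**: `t ↦ (-8π sin 2πt, 2 cos 2πt)`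
(`ω(ċ, e₁) = 4⟪J₀ ċ, e₁⟫ = 4 ċ₀`, `α(e₁) = 2⟪J₀ x, e₁⟫ = 2 x₀`). [folklore] -/
theorem twistingLoop_legendrianUnknot_seifertFraming (t : ℝ) :
    steinStructureClosedBall.twistingLoop legendrianUnknot seifertFraming t =
      ⟨-(8 * Real.pi * Real.sin (2 * Real.pi * t)), 2 * Real.cos (2 * Real.pi * t)⟩ := by
  rw [SteinStructure.twistingLoop_apply, kahlerForm_steinStructureClosedBall,
    contactForm_steinStructureClosedBall, closedBallCoeDeriv_seifertFraming,
    closedBallCoeDeriv_knotVelocity_legendrianUnknot, inner_stdComplexStructure_imagAxis,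
    inner_stdComplexStructure_imagAxis, unknotVelocityAmb_apply_zero, coe_legendrianUnknot,
    realPlaneLin_apply_zero, circlePt_apply_zero]
  apply Complex.ext
  · simp; ring
  · simp

/-- The comparison loop `t ↦ i (4π + 1) e^{2πit}` winds once about `0`. [folklore] -/
theorem wind_I_mul_circleLoop :
    Literature.Topology.PlaneTopology.wind
        (fun t => (Complex.I : ℂ) * Literature.Topology.PlaneTopology.circleLoop 0 (4 * Real.pi + 1) t) = 1 := by
  have hR : (0 : ℝ) < 4 * Real.pi + 1 := by positivity
  have hI : Literature.Topology.PlaneTopology.IsNonvanishingLoop fun _ : ℝ => (Complex.I : ℂ) :=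
    Literature.Topology.PlaneTopology.IsNonvanishingLoop.const Complex.I_ne_zero
  have hC : Literature.Topology.PlaneTopology.IsNonvanishingLoop
      (Literature.Topology.PlaneTopology.circleLoop 0 (4 * Real.pi + 1)) :=
    Literature.Topology.PlaneTopology.isNonvanishingLoop_circleLoop (by
      rw [norm_zero, abs_of_pos hR]; exact hR.ne)
  rw [Literature.Topology.PlaneTopology.wind_mul hI hC, Literature.Topology.PlaneTopology.wind_const,
    Literature.Topology.PlaneTopology.wind_circleLoop_zero hR, zero_add]

/-- **The Seifert framing of the standard Legendrian unknot has twisting number `+1`** with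
respect to the canonical (contact) framing: `f - tb = 0 - (-1)`, i.e. `tb(K₀) = -1`, one
*right-handed* twist — pinning the sign convention of `SteinStructure.twisting` on the model.
[cite: Gompf1998, §1] -/
theorem twisting_legendrianUnknot_seifertFraming :
    steinStructureClosedBall.twisting legendrianUnknot seifertFraming = 1 := by
  unfold SteinStructure.twisting
  have hfun : steinStructureClosedBall.twistingLoop legendrianUnknot seifertFraming = fun t : ℝ =>
      (⟨-(8 * Real.pi * Real.sin (2 * Real.pi * t)), 2 * Real.cos (2 * Real.pi * t)⟩ : ℂ) :=
    funext twistingLoop_legendrianUnknot_seifertFraming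
  rw [hfun, ← wind_I_mul_circleLoop]
  have hR : (0 : ℝ) < 4 * Real.pi + 1 := by positivity
  have hg : Literature.Topology.PlaneTopology.IsNonvanishingLoop
      (fun t => (Complex.I : ℂ) * Literature.Topology.PlaneTopology.circleLoop 0 (4 * Real.pi + 1) t) :=
    (Literature.Topology.PlaneTopology.IsNonvanishingLoop.const Complex.I_ne_zero).mul
      (Literature.Topology.PlaneTopology.isNonvanishingLoop_circleLoop (by
        rw [norm_zero, abs_of_pos hR]; exact hR.ne))
  refine Literature.Topology.PlaneTopology.wind_eq_of_norm_sub_lt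
    (continuous_complex_mk (by fun_prop) (by fun_prop)).continuousOn ?_ hg ?_
  · apply Complex.ext <;> simp
  · intro t _
    have hg' : (Complex.I : ℂ) * Literature.Topology.PlaneTopology.circleLoop 0 (4 * Real.pi + 1) t =
        ⟨-((4 * Real.pi + 1) * Real.sin (2 * Real.pi * t)), (4 * Real.pi + 1) * Real.cos (2 * Real.pi * t)⟩ := by
      rw [Literature.Topology.PlaneTopology.circleLoop_apply, zero_add]
      apply Complex.ext
      · simp [Complex.exp_re, Complex.exp_im, mul_comm]
      · simp [Complex.exp_re, Complex.exp_im, mul_comm]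
    rw [hg']
    have hπ : (2 : ℝ) ≤ Real.pi := Real.two_le_pi
    have hsc := Real.sin_sq_add_cos_sq (2 * Real.pi * t)
    have hn1 : ‖((⟨-(8 * Real.pi * Real.sin (2 * Real.pi * t)), 2 * Real.cos (2 * Real.pi * t)⟩ : ℂ) -
        ⟨-((4 * Real.pi + 1) * Real.sin (2 * Real.pi * t)), (4 * Real.pi + 1) * Real.cos (2 * Real.pi * t)⟩)‖ =
          4 * Real.pi - 1 := by
      rw [Complex.norm_def, Complex.normSq_apply]
      rw [Real.sqrt_eq_iff_mul_self_eq_of_pos (by linarith)]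
      simp; nlinarith [hsc]
    have hn2 : ‖((⟨-((4 * Real.pi + 1) * Real.sin (2 * Real.pi * t)),
        (4 * Real.pi + 1) * Real.cos (2 * Real.pi * t)⟩ : ℂ))‖ = 4 * Real.pi + 1 := by
      rw [Complex.norm_def, Complex.normSq_apply]
      rw [Real.sqrt_eq_iff_mul_self_eq_of_pos (by linarith)]
      simp; nlinarith [hsc]
    rw [hn1, hn2]; linarith

/-- Hence the **defect** of a `2`-handle attached along the Seifert (`0`-)framed Legendrian
unknot is `2` (`max{f + 1 - tb, 0} = 0 + 1 + 1`). [cite: AkbulutMatveyev1998, §3] -/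
theorem defect_legendrianUnknot_seifertFraming :
    steinStructureClosedBall.defect legendrianUnknot seifertFraming = 2 := by
  rw [SteinStructure.defect, twisting_legendrianUnknot_seifertFraming]; rfl

/-- In particular the Seifert-framed Legendrian unknot has non-zero defect: Eliashberg's theorem
(framing `tb - 1`, i.e. twisting `-1`) does not apply to the `0`-framed unknot — as it must not,
`B⁴ ∪_{K₀, 0} h² = S² × D²` containing an essential sphere of self-intersection `0`.
[cite: AkbulutMatveyev1998, §3] -/
theorem defect_legendrianUnknot_seifertFraming_ne_zero :
    steinStructureClosedBall.defect legendrianUnknot seifertFraming ≠ 0 := by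
  rw [defect_legendrianUnknot_seifertFraming]; decide

/-! ### The canonical framing has twisting number `0` -/

section General

variable {W : Type*} [TopologicalSpace W] [ChartedSpace (EuclideanHalfSpace 4) W]
  [IsManifold (𝓡∂ 4) ∞ W] [CompactSpace W]

/-- **The canonical framing of a Legendrian knot has twisting number `0`.**  Its twisting loop
is the positive real function `t ↦ ω(ċ, Jċ)` (`IsLegendrianKnot.twistingLoop_canonicalFraming`),
so every continuous logarithm of it on `[0, 1]` differs from the real logarithm by a constant and
`wind = 0`; when the loop is not continuous (bundle-level continuity of `ω` along `K` is not
recorded by `IsLegendrianKnot`) `Literature.Topology.PlaneTopology.wind` returns its junk value,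
which is `0` as well, so the statement holds unconditionally. [cite: Gompf1998, §1] -/
theorem IsLegendrianKnot.twisting_canonicalFraming {S : SteinStructure W} {K : 𝕊 1 → W}
    (hK : IsLegendrianKnot S.J K) : S.twisting K (canonicalFraming S.J K) = 0 := by
  unfold SteinStructure.twisting
  set f : ℝ → ℂ := S.twistingLoop K (canonicalFraming S.J K) with hf
  by_cases h : Literature.Topology.PlaneTopology.HasLogOn f (Icc 0 1) ∧ f 0 = f 1
  · -- the real logarithm of the positive real loop closes up
    have hre : ∀ t, f t = ((f t).re : ℂ) ∧ 0 < (f t).re := fun t => by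
      obtain ⟨h1, h2⟩ := hK.twistingLoop_canonicalFraming t
      refine ⟨?_, ?_⟩
      · rw [hf, h1]; simp
      · rw [hf, h1]; simpa using h2
    set l : ℝ → ℂ := fun t => (Real.log (f t).re : ℂ) with hl
    have hlc : ContinuousOn l (Icc 0 1) := by
      have hc : ContinuousOn (fun t => (f t).re) (Icc 0 1) :=
        Complex.continuous_re.comp_continuousOn h.1.continuousOn
      exact Complex.continuous_ofReal.comp_continuousOn
        (hc.log fun t _ => (hre t).2.ne')
    have hle : ∀ t ∈ Icc (0 : ℝ) 1, Complex.exp (l t) = f t := fun t _ => by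
      rw [hl]
      simp only
      rw [← Complex.ofReal_exp, Real.exp_log (hre t).2, ← (hre t).1]
    have hspec := Literature.Topology.PlaneTopology.wind_spec hlc hle h.2
    have h0 : l 1 - l 0 = 0 := by
      rw [hl]; simp only; rw [h.2, sub_self]
    rw [h0] at hspec
    have h2pi : (2 * (Real.pi : ℂ) * Complex.I) ≠ 0 := by
      simp [Real.pi_ne_zero, Complex.I_ne_zero]
    have := mul_eq_zero.1 hspec.symm
    rcases this with h' | h'
    · exact_mod_cast h'
    · exact absurd h' h2pi
  · rw [Literature.Topology.PlaneTopology.wind, dif_neg h]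

end General

/-- In particular for the standard Legendrian unknot: its canonical (`tb`) framing `J₀ ċ` has
twisting `0`, its Seifert framing twisting `+1`. [cite: Gompf1998, §1] -/
theorem twisting_legendrianUnknot_canonicalFraming :
    steinStructureClosedBall.twisting legendrianUnknot
      (canonicalFraming steinStructureClosedBall.J legendrianUnknot) = 0 :=
  isLegendrianKnot_legendrianUnknot.twisting_canonicalFraming

end Literature.Geometry.Symplectic

end
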